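import Summits.Ventures.DiscreteObjects.PP12.TriangleCase

/-!
# PP(12), family B1-p: fixed-point counts — homologies fix `n + 2` points; order 7 fixes a `2-(31,6,1)` configuration
Framing: lottery ticket; floor = certified bounds/negative ranges.

* `fixedCard_eq_of_homology` — in a plane of order `n`, a non-trivial collineation with an axis `l` and a centre
  `c ∉ l` fixes exactly the `n + 2` points of `l ∪ {c}` (Case A of FAMILY-B1P Lemma 4: `f = 14` for `n = 12`).
* Order 12, `σ⁷ = 1`, `σ ≠ 1` (FAMILY-B1P Lemma 3, kernel part): every fixed line carries exactly `6` fixed points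
  (`fixedOnLine_eq_six_q7`), every fixed point lies on exactly `6` fixed lines (`fixedThrough_eq_six_q7`), and there
  are exactly `31` fixed points (`fixedCard_eq_31_q7`) — i.e. the fixed structure is a `2-(31,6,1)` design, a
  subplane of order 5, which Bruck's subplane bound (`12 ≠ 5²`, `12 < 5² + 5`; NOT formalised here) forbids.
-/

namespace Summit.Ventures.DiscreteObjects.PP12

open Configuration Finset

namespace Collineation

variable {P L : Type*} [Membership P L] [ProjectivePlane P L] [Fintype P] [Fintype L]
  [DecidableEq P] [DecidableEq L] (σ : Collineation P L)

omit [DecidableEq L] in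
/-- **Homology fixed points.** A non-trivial collineation with axis `l` and centre `c ∉ l` fixes exactly the
`n + 2` points of `l ∪ {c}`. -/
theorem fixedCard_eq_of_homology {l : L} {c : P} (hl : σ.IsAxis l) (hc : σ.IsCenter c) (hcl : c ∉ l)
    (hne : σ.onPoints ≠ 1) : fixedCard σ.onPoints = ProjectivePlane.order P L + 2 := by
  classical
  unfold fixedCard
  have hset : (univ.filter fun x : P => σ.onPoints x = x) = insert c (univ.filter fun x : P => x ∈ l) := by
    ext x
    simp only [mem_filter, mem_univ, true_and, mem_insert]
    constructor
    · intro fx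
      by_contra h
      push Not at h
      apply hne
      ext s
      simpa using σ.eq_self_of_central_of_fixed hl hc h.2 h.1 fx s
    · rintro (rfl | hx)
      · exact σ.center_fixed hl hc
      · exact hl x hx
  rw [hset, Finset.card_insert_of_notMem (by simpa using hcl)]
  have hcard : (univ.filter fun x : P => x ∈ l).card = ProjectivePlane.order P L + 1 := by
    rw [← ProjectivePlane.pointCount_eq P l, pointCount, Nat.card_eq_fintype_card, Fintype.card_subtype]
  rw [hcard]

section OrderTwelveSeven

variable (h12 : ProjectivePlane.order P L = 12) (hne : σ.onPoints ≠ 1) (hq : σ.onPoints ^ 7 = 1)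
include h12 hne hq

omit [DecidableEq L] in
/-- Order 12, `σ⁷ = 1`: every fixed line carries exactly 6 fixed points (13 would make it an axis). -/
theorem fixedOnLine_eq_six_q7 {l : L} [DecidablePred (· ∈ l)] (hl : σ.onLines l = l) :
    σ.fixedOnLine l = 6 := by
  haveI : Fact (Nat.Prime 7) := ⟨by norm_num⟩
  rcases σ.fixedOnLine_order12_q7 h12 hl hq with h6 | h13
  · exact h6
  · exfalso
    have hax : σ.IsAxis l := σ.isAxis_of_fixedOnLine_eq (by rw [h13, h12])
    exact σ.not_isAxis_order12 h12 hne hq (Or.inr (Or.inl rfl)) l hax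

omit [DecidableEq P] in
/-- Order 12, `σ⁷ = 1`: every fixed point lies on exactly 6 fixed lines (dual argument). -/
theorem fixedThrough_eq_six_q7 {p : P} [DecidablePred fun m : L => p ∈ m] (hp : σ.onPoints p = p) :
    σ.fixedThrough p = 6 := by
  haveI : Fact (Nat.Prime 7) := ⟨by norm_num⟩
  rw [fixedThrough_eq_dual]
  have h12' : ProjectivePlane.order (Dual L) (Dual P) = 12 := by rw [ProjectivePlane.Dual.order]; exact h12
  have hneL : σ.dual.onPoints ≠ 1 := fun h => hne (σ.onPoints_eq_one_of_onLines h)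
  have hqL : σ.dual.onPoints ^ 7 = 1 := σ.onLines_pow_eq_one hq
  exact σ.dual.fixedOnLine_eq_six_q7 h12' hneL hqL hp

/-- Order 12, `σ⁷ = 1`: exactly 31 fixed points (`1 + 6·5`: the other fixed points are distributed over the 6
fixed lines through a fixed point, 5 on each). With the 31 fixed lines this is a subplane of order 5 —
excluded by Bruck's bound (paper step). -/
theorem fixedCard_eq_31_q7 : fixedCard σ.onPoints = 31 := by
  classical
  haveI : Fact (Nat.Prime 7) := ⟨by norm_num⟩
  have hmod := (σ.fixedCard_order12 h12).2.1 hq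
  set S : Finset P := univ.filter fun x => σ.onPoints x = x with hS
  have hSdef : fixedCard σ.onPoints = S.card := rfl
  have hpos : S.card ≠ 0 := by rw [← hSdef]; omega
  obtain ⟨p, hpS⟩ := Finset.card_pos.mp (Nat.pos_of_ne_zero hpos)
  have hp : σ.onPoints p = p := by simpa [hS] using hpS
  set T : Finset L := univ.filter fun m : L => p ∈ m ∧ σ.onLines m = m with hT
  have hTcard : T.card = 6 := σ.fixedThrough_eq_six_q7 h12 hne hq hp
  obtain ⟨l₀, -⟩ := Nondegenerate.exists_line (L := L) p
  let f : P → L := fun Q => if h : p = Q then l₀ else HasLines.mkLine h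
  have hf : ∀ Q ∈ S.erase p, p ∈ f Q ∧ Q ∈ f Q ∧ σ.onLines (f Q) = f Q := by
    intro Q hQ
    have hQp : Q ≠ p := (Finset.mem_erase.mp hQ).1
    have hQfix : σ.onPoints Q = Q := by simpa [hS] using (Finset.mem_erase.mp hQ).2
    simp only [f, dif_neg hQp.symm]
    have hax := HasLines.mkLine_ax (L := L) hQp.symm
    exact ⟨hax.1, hax.2, σ.line_fixed_of_two_fixed hax.1 hax.2 hQp.symm hp hQfix⟩
  have hmaps : ∀ Q ∈ S.erase p, f Q ∈ T := fun Q hQ => by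
    obtain ⟨h1, -, h3⟩ := hf Q hQ
    simp [hT, h1, h3]
  -- fibre over a fixed line m through p = the fixed points of m other than p (5 of them)
  have hfib : ∀ m ∈ T, ((S.erase p).filter fun Q => f Q = m).card = 5 := by
    intro m hm
    have hpm : p ∈ m := by simp [hT] at hm; exact hm.1
    have fm : σ.onLines m = m := by simp [hT] at hm; exact hm.2
    have hset : ((S.erase p).filter fun Q => f Q = m)
        = (univ.filter fun x : P => x ∈ m ∧ σ.onPoints x = x).erase p := by
      ext Q
      simp only [mem_filter, mem_erase, mem_univ, true_and, hS]
      constructor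
      · rintro ⟨⟨hQp, hQfix⟩, hQm⟩
        have := (hf Q (by simp [hS, hQp, hQfix])).2.1
        rw [hQm] at this
        exact ⟨hQp, this, hQfix⟩
      · rintro ⟨hQp, hQm, hQfix⟩
        refine ⟨⟨hQp, hQfix⟩, ?_⟩
        obtain ⟨h1, h2, -⟩ := hf Q (by simp [hS, hQp, hQfix])
        exact (Nondegenerate.eq_or_eq h1 h2 hpm hQm).resolve_left hQp.symm
    rw [hset, Finset.card_erase_of_mem (by simp [hpm, hp])]
    have h6 : σ.fixedOnLine m = 6 := σ.fixedOnLine_eq_six_q7 h12 hne hq fm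
    unfold fixedOnLine at h6
    rw [h6]
  have hsum := Finset.card_eq_sum_card_fiberwise hmaps
  rw [Finset.sum_congr rfl hfib, Finset.sum_const, hTcard, smul_eq_mul] at hsum
  rw [hSdef, ← Finset.card_erase_add_one hpS, hsum]

end OrderTwelveSeven

end Collineation

end Summit.Ventures.DiscreteObjects.PP12
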